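import Literature.NumberTheory.GaloisCohomology.CupProductLocalTermsShapiro
import Literature.NumberTheory.GaloisRepresentations.InertiaPrincipalConjugates
import HarnessLib

/-!
# The exact core identity for two Shapiro lifts, with the off-`T` and archimedean inputs in CONSUMER form:
# classes dying on `U ⊓ I_𝔓` off `T` (Kato / unramified Selmer classes) and `C₂`-regular coefficients at the real places

Topic `NumberTheory/GaloisCohomology`, namespace `Literature.NumberTheory.GaloisCohomology`. THEOREMS ONLY. Composition of three landed
pieces: `sum_localInvariantMap_cupProduct_shapiroLift_eq_zero_of_right` (`CupProductLocalTermsShapiro` §4: Brauer sum + (U) + (ShU) + (AR)),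
`forall_exists_forall_absInertia_conj_apply_eq_of_forall_primesAbove` (`InertiaPrincipalConjugates`: `res_{U ⊓ I_𝔓}[ψ] = 0` for all
`𝔓 ∣ v` ⟹ the conjugates of `ψ` are principal on `I_{K_v}`) and `localization_inl_shapiroLift_eq_zero_of_forall_antifixed` (§6: no
antifixed vectors modulo coboundaries for the conjugate complex conjugations ⟹ `loc_w(Sh ψ) = 0`).

* `sum_localInvariantMap_cupProduct_shapiroLift_eq_zero_of_resLe_inertia` — for discrete `Γ_K`-modules `M₁, M₂`, an open `U ≤ Γ_K` of
  finite index with representatives `s`, a pairing `P : Maps(Γ_K ⧸ U, M₁) × Maps(Γ_K ⧸ U, M₂) → μₙ` (`n = p^r`), a finite set `T` of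
  finite places, cocycles `ψ₁ : U → M₁`, `ψ₂ : U → M₂` with `res_{U ⊓ I_𝔓}[ψᵢ] = 0` for every prime `𝔓` over every `v ∉ T`, and `M₂`
  `C₂`-regular for every conjugate involution at every infinite place: **`Σ_{v ∈ T} inv_v loc_v(Sh ψ₁ ∪ Sh ψ₂) = 0`**.
* `two_nsmul_sum_localInvariantMap_cupProduct_shapiroLift_eq_zero_of_resLe_inertia` — the `2 •` form without any archimedean input.

Consumer: the levelwise reciprocity (EH) of crux RSL_g `ResidualSignedLambdaLowerCMAtTwo` (`Summits/BirchSwinnertonDyer`, route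
`ResidualThetaTransportAtTwo`) with `K = ℚ`, `U = Γ_{ℚ_n}`, `M₁ = M₂ = A_ρ[2^k]` (`C₂`-regular on the habitat `Δ_W < 0`:
`Theorems/…CofreeRegularAtInfinity`), `T = {2} ∪ S₀ ∪ {ℓ ∣ M}`; the `T`-terms are read orbit by orbit (`CyclotomicLayerPairingOfFunMackey`).

References: [MilneADT2006] Ch. I Thm. 2.6, Thm. 4.10 (b); [NeukirchSchmidtWingberg2008] I §6 Prop. (1.6.4), VIII §1; [NeukirchANT1999]
Ch. II §9 Prop. (9.6).
-/

noncomputable section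

open CategoryTheory Function Field NumberField IsDedekindDomain
open scoped NumberField

namespace Literature.NumberTheory.GaloisCohomology

open _root_.ContinuousCohomology _root_.TopRep
open Literature.NumberTheory.GaloisRepresentations
open Literature.NumberTheory.GaloisRepresentations.DiscreteGaloisModule

variable (K : Type) [Field K] [NumberField K] (n : ℕ) [NeZero n]

/-- **`2 • Σ_{v ∈ T} inv_v loc_v(Sh ψ₁ ∪ Sh ψ₂) = 0`** for cocycles `ψ₁, ψ₂ : U → Mᵢ` whose classes die on `U ⊓ I_𝔓` for every prime
`𝔓` over every finite place `v ∉ T` (then all conjugates are principal on `I_{K_v}`, the localisations of the Shapiro lifts are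
unramified and pair to zero off `T`; the archimedean terms are `2`-torsion). [cite: MilneADT2006, Ch. I, Thm. 2.6 and Thm. 4.10(b)]
[cite: NeukirchSchmidtWingberg2008, I §6 Prop. (1.6.4)] [cite: NeukirchANT1999, Ch. II §9 Prop. (9.6)] -/
theorem two_nsmul_sum_localInvariantMap_cupProduct_shapiroLift_eq_zero_of_resLe_inertia {p : ℕ} [Fact p.Prime]
    (hn : ∃ r : ℕ, n = p ^ r)
    {M₁ M₂ : Type} [AddCommGroup M₁] [TopologicalSpace M₁] [DiscreteTopology M₁]
    [AddCommGroup M₂] [TopologicalSpace M₂] [DiscreteTopology M₂]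
    (ρ₁ : DiscreteGaloisModule K M₁) (ρ₂ : DiscreteGaloisModule K M₂)
    (U : Subgroup (absoluteGaloisGroup K)) (hU : IsOpen (U : Set (absoluteGaloisGroup K)))
    [Fintype (absoluteGaloisGroup K ⧸ U)]
    {s : absoluteGaloisGroup K ⧸ U → absoluteGaloisGroup K} (hs : ∀ x, (s x : absoluteGaloisGroup K ⧸ U) = x)
    (hs1 : s ((1 : absoluteGaloisGroup K) : absoluteGaloisGroup K ⧸ U) = 1)
    (P : ContPairing (ρ₁.coind U hU).toTopRep (ρ₂.coind U hU).toTopRep (mu K n).toTopRep)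
    (T : Finset (HeightOneSpectrum (𝓞 K)))
    (ψ₁ : contOneCocycles (subgroupRep ρ₁.toTopRep U)) (ψ₂ : contOneCocycles (subgroupRep ρ₂.toTopRep U))
    (hψ₁ : ∀ v : HeightOneSpectrum (𝓞 K), v ∉ T → ∀ 𝔓 ∈ v.primesAbove,
      resLe ρ₁.toTopRep (inf_le_left : U ⊓ 𝔓.inertia (absoluteGaloisGroup K) ≤ U) 1 (oneCocycleClass _ ψ₁) = 0)
    (hψ₂ : ∀ v : HeightOneSpectrum (𝓞 K), v ∉ T → ∀ 𝔓 ∈ v.primesAbove,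
      resLe ρ₂.toTopRep (inf_le_left : U ⊓ 𝔓.inertia (absoluteGaloisGroup K) ≤ U) 1 (oneCocycleClass _ ψ₂) = 0) :
    2 • ∑ v ∈ T, localInvariantMap K n v (galoisCohomology.localization (mu K n) (Sum.inr v) 2
      (P.cupProduct (shapiroLift ρ₁.toTopRep U hU hs hs1 (oneCocycleClass _ ψ₁))
        (shapiroLift ρ₂.toTopRep U hU hs hs1 (oneCocycleClass _ ψ₂)))) = 0 :=
  two_nsmul_sum_localInvariantMap_cupProduct_shapiroLift_eq_zero K n hn ρ₁ ρ₂ U hU hs hs1 P T ψ₁ ψ₂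
    (fun v hv ↦ forall_exists_forall_absInertia_conj_apply_eq_of_forall_primesAbove K ρ₁.toTopRep U v ψ₁ (hψ₁ v hv) s)
    (fun v hv ↦ forall_exists_forall_absInertia_conj_apply_eq_of_forall_primesAbove K ρ₂.toTopRep U v ψ₂ (hψ₂ v hv) s)

/-- **The exact core identity in consumer form: `Σ_{v ∈ T} inv_v loc_v(Sh ψ₁ ∪ Sh ψ₂) = 0`** for cocycles whose classes die on
`U ⊓ I_𝔓` off `T`, when the second coefficient module `M₂` has NO antifixed vectors modulo coboundaries for every conjugate involution
`s(y₀)⁻¹ · d|_{K̄} · s(y₀) ∈ U` (`d ≠ 1` in `Γ_{K_w}`, `w` infinite) — e.g. `M₂` a regular `C₂`-module (Brown VI §8); then every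
archimedean term vanishes (`localization_inl_shapiroLift_eq_zero_of_forall_antifixed`). [cite: MilneADT2006, Ch. I, Thm. 2.6 and Thm. 4.10(b)]
[cite: NeukirchSchmidtWingberg2008, I §6 Prop. (1.6.4)] [cite: NeukirchANT1999, Ch. II §9 Prop. (9.6)] -/
theorem sum_localInvariantMap_cupProduct_shapiroLift_eq_zero_of_resLe_inertia {p : ℕ} [Fact p.Prime]
    (hn : ∃ r : ℕ, n = p ^ r)
    {M₁ M₂ : Type} [AddCommGroup M₁] [TopologicalSpace M₁] [DiscreteTopology M₁]
    [AddCommGroup M₂] [TopologicalSpace M₂] [DiscreteTopology M₂]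
    (ρ₁ : DiscreteGaloisModule K M₁) (ρ₂ : DiscreteGaloisModule K M₂)
    (U : Subgroup (absoluteGaloisGroup K)) (hU : IsOpen (U : Set (absoluteGaloisGroup K)))
    [Fintype (absoluteGaloisGroup K ⧸ U)]
    {s : absoluteGaloisGroup K ⧸ U → absoluteGaloisGroup K} (hs : ∀ x, (s x : absoluteGaloisGroup K ⧸ U) = x)
    (hs1 : s ((1 : absoluteGaloisGroup K) : absoluteGaloisGroup K ⧸ U) = 1)
    (P : ContPairing (ρ₁.coind U hU).toTopRep (ρ₂.coind U hU).toTopRep (mu K n).toTopRep)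
    (T : Finset (HeightOneSpectrum (𝓞 K)))
    (ψ₁ : contOneCocycles (subgroupRep ρ₁.toTopRep U)) (ψ₂ : contOneCocycles (subgroupRep ρ₂.toTopRep U))
    (hψ₁ : ∀ v : HeightOneSpectrum (𝓞 K), v ∉ T → ∀ 𝔓 ∈ v.primesAbove,
      resLe ρ₁.toTopRep (inf_le_left : U ⊓ 𝔓.inertia (absoluteGaloisGroup K) ≤ U) 1 (oneCocycleClass _ ψ₁) = 0)
    (hψ₂ : ∀ v : HeightOneSpectrum (𝓞 K), v ∉ T → ∀ 𝔓 ∈ v.primesAbove,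
      resLe ρ₂.toTopRep (inf_le_left : U ⊓ 𝔓.inertia (absoluteGaloisGroup K) ≤ U) 1 (oneCocycleClass _ ψ₂) = 0)
    (hanti : ∀ (w : InfinitePlace K) (y₀ : absoluteGaloisGroup K ⧸ U)
      (d : absoluteGaloisGroup (Place.Completion (Sum.inl w : Place K))), d ≠ 1 →
      (s y₀)⁻¹ * absGaloisRestrict K (Place.Completion (Sum.inl w : Place K)) d * s y₀ ∈ U →
      ∀ a : M₂, ρ₂.toTopRep.ρ ((s y₀)⁻¹ * absGaloisRestrict K (Place.Completion (Sum.inl w : Place K)) d * s y₀) a = -a →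
        ∃ b : M₂, a = ρ₂.toTopRep.ρ ((s y₀)⁻¹ * absGaloisRestrict K (Place.Completion (Sum.inl w : Place K)) d * s y₀) b - b) :
    ∑ v ∈ T, localInvariantMap K n v (galoisCohomology.localization (mu K n) (Sum.inr v) 2
      (P.cupProduct (shapiroLift ρ₁.toTopRep U hU hs hs1 (oneCocycleClass _ ψ₁))
        (shapiroLift ρ₂.toTopRep U hU hs hs1 (oneCocycleClass _ ψ₂)))) = 0 :=
  sum_localInvariantMap_cupProduct_shapiroLift_eq_zero_of_right K n hn ρ₁ ρ₂ U hU hs hs1 P T ψ₁ ψ₂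
    (fun v hv ↦ forall_exists_forall_absInertia_conj_apply_eq_of_forall_primesAbove K ρ₁.toTopRep U v ψ₁ (hψ₁ v hv) s)
    (fun v hv ↦ forall_exists_forall_absInertia_conj_apply_eq_of_forall_primesAbove K ρ₂.toTopRep U v ψ₂ (hψ₂ v hv) s)
    fun w ↦ localization_inl_shapiroLift_eq_zero_of_forall_antifixed K ρ₂ U hU hs hs1 w ψ₂ (hanti w)

end Literature.NumberTheory.GaloisCohomology

end
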